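import Summits.ResolutionOfSingularities.ResolutionOfSingularities.Theorems.PurelyInseparableDim4ChartAtlasSNCFarRepair
import Summits.ResolutionOfSingularities.ResolutionOfSingularities.Theorems.PurelyInseparableDim4ChartCentreZigzag
import Literature.AlgebraicGeometry.Resolution.BlowupDisjointCentreSplitting
import Literature.AlgebraicGeometry.Resolution.BlowupSequencesLocalIsoDescent
import Literature.AlgebraicGeometry.Resolution.MarkedIdealsLemmas
import HarnessLib

/-!
# Purely inseparable four-folds `z^p + F(x₁, …, x₄)`: simple normal crossings with a DISCONNECTED centre — the keystone of the
# two-height far-resonance repair (cell `res-dim4-pi`, typ-2 g6; HANDOFF OPEN 2, memo S3-N2-SNC-CRITERION §11:20Z, file F1 (i))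

[OURS · counted 0] (D-0157 DOOR 2; DR-157-C.) The far-resonance repair R1–R5 (p706678 … p709208) removes the resonances at ONE height `c′`
by blowing up `Σ′ = Zc ∩ {y_j = c′}`. Resonances at two heights `c′ ≠ c″` want ONE blow-up along the disjoint union `Σ′ ⊔ Σ″`, i.e. along the
product ideal sheaf `𝓘(Σ′)·𝓘(Σ″)` (Literature `vanishingIdeal_sup_eq_mul_of_disjoint`, `IsBlowup.exists_comp_eq_of_disjoint_union`,
`isRegular_subscheme_mul_of_disjoint_support`). PROVED here (no `sorry`, no new axiom), for any scheme:

* `hasSNCWith_mul_of_disjoint_support` — **a boundary snc with each of two centres of DISJOINT support is snc with their product** (stalkwise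
  the product is one factor: `(I·J)_x = I_x` off `V(J)`, `= J_x` off `V(I)`); any scheme;
* `hasSNCWith_𝓘Λ_insert_comap_translate_of_forall_mem_far_translated` — R1 (p706678) AT A SECOND HEIGHT: in R1's frame (first resonance at
  `y_j = 0`) the second centre `Σ″ = {y_0 = y_T = 0, y_j = δ}` is `ψ^*Σ′` for the translation `ψ : y_j ↦ y_j − δ`, and the chart-model boundary
  (hyperplanes, translated far quadrics `TQ_k`) is snc with it — R1 in the frame `y_j ↦ y_j − δ` (the `TQ` alphabet is closed under
  `y_j`-translations: `c′ ↦ c′ − δ`, `e_k ↦ e_k + b_k δ`, `e_k + b_k c′` invariant), transported by Literature `HasSNCWith.of_comap_of_isLocalIso`;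
* **`hasSNCWith_twoHeights_of_forall_mem_far_translated`** — «`Σ′ ⊔ Σ″` IS A REGULAR CENTRE SNC WITH THE WHOLE CHART-MODEL BOUNDARY»: the product
  `𝓘(Σ′)·ψ^*𝓘(Σ′)` has disjoint factors (`δ ≠ 0`), is snc with the boundary and has a regular zero scheme (Literature
  `isRegular_subscheme_mul_of_disjoint_support`, p695335 `isRegular_subscheme_comap_𝓘Λ`).

The sequential form of the two-height step is Literature `IsBlowup.exists_comp_eq_of_disjoint_union` + `HasSNCWith.transform_comap_of_disjoint`
(memo §11:20Z, files F2/F3 not typed). Nothing here is a statement about resolution of singularities in dimension ≥ 4 /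
characteristic `p` (NOT proved anywhere in this programme). bears_on: LADDER-RESOLUTION:D157-DOOR2 (res-dim4-pi). Supports
stmt-ResolutionOfSingularities-16155 (helper).
-/

-- every declaration of this summit lives under `Summit.ResolutionOfSingularities.ResolutionOfSingularities`
-- (summit = problem), which the duplicate-namespace linter flags; house convention (cf. the Target file).
set_option linter.dupNamespace false

noncomputable section

open CategoryTheory AlgebraicGeometry TopologicalSpace

namespace Summit.ResolutionOfSingularities.ResolutionOfSingularities.Theorems.PIDim4

open Literature.AlgebraicGeometry.Resolution

namespace ChartDictionary

universe u

section Generic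

variable {X : Scheme.{u}}

/-- **SNC WITH A DISCONNECTED CENTRE.** If the boundary `E` has simple normal crossings with each of two centres `I`, `J` whose supports are
disjoint, then it has simple normal crossings with the product `I·J` (whose zero locus is the disjoint union `V(I) ⊔ V(J)`): at a point of
`V(J)` the stalk of `I` is the unit ideal, so `(I·J)_x = J_x`, and symmetrically. Companion of Literature `isRegular_subscheme_mul_of_disjoint_support`. -/
theorem hasSNCWith_mul_of_disjoint_support {E : List X.IdealSheafData} {I J : X.IdealSheafData} (hI : HasSNCWith E I)
    (hJ : HasSNCWith E J) (h : Disjoint (I.support : Set X) J.support) : HasSNCWith E (I * J) := by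
  intro x
  by_cases hxJ : x ∈ J.support
  · have hxI : x ∉ I.support := fun h' => h.le_bot ⟨h', hxJ⟩
    obtain ⟨hreg, u, hu, hι, hC⟩ := hJ x
    refine ⟨hreg, u, hu, hι, fun _ => ?_⟩
    rw [stalkIdeal_mul, stalkIdeal_eq_top_of_not_mem_support hxI, Ideal.top_mul]
    exact hC hxJ
  · obtain ⟨hreg, u, hu, hι, hC⟩ := hI x
    refine ⟨hreg, u, hu, hι, fun hx => ?_⟩
    rw [stalkIdeal_mul, stalkIdeal_eq_top_of_not_mem_support hxJ, Ideal.mul_top]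
    have hx' : x ∈ ((I.support ⊔ J.support : Closeds X) : Set X) := by
      rwa [Scheme.IdealSheafData.support_mul] at hx
    rw [Closeds.coe_sup] at hx'
    exact hC (hx'.resolve_right hxJ)

end Generic

section TwoHeights

open MvPolynomial
open AlgebraicGeometry.Scheme.IdealSheafData (ofIdealTop)
open Literature.AlgebraicGeometry.Resolution.AffinePointBlowup (P A γ)

variable {K : Type} [Field K] {T : Finset (Fin 4)} {j : Fin 4} {b e : Fin 4 → K} {c' δ : K}

/-- The translation `y_j ↦ y_j + t` of `𝔸⁵` fixes constants. -/
theorem translateEquiv_single_C (t a : K) :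
    AffinePointBlowup.translateEquiv (n := 4) (Pi.single j.succ t) (C a) = C a :=
  (AffinePointBlowup.translateEquiv (n := 4) (Pi.single j.succ t)).commutes a

/-- The translation `y_j ↦ y_j + t` on a translated hyperplane: `y_m + a ↦ y_m + ([m = j⁺]·t + a)`. -/
theorem translateEquiv_single_hyperplane (t : K) (m : Fin (4 + 1)) (a : K) :
    AffinePointBlowup.translateEquiv (n := 4) (Pi.single j.succ t) (X m + C a) = X m + C (Pi.single (M := fun _ => K) j.succ t m + a) := by
  rw [map_add, AffinePointBlowup.translateEquiv_X, translateEquiv_single_C, C_add, add_assoc]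

/-- The translation `y_j ↦ y_j + t` on a translated far quadric: `TQ_k(b, c′, e) ↦ TQ_k(b, c′ − t, e + b·t)` — the `TQ` alphabet is closed
under `y_j`-translations. -/
theorem translateEquiv_single_tquadric (t : K) {k : Fin 4} (hkj : k ≠ j) :
    AffinePointBlowup.translateEquiv (n := 4) (Pi.single j.succ t) ((X k.succ + C (b k)) * X j.succ - C c' * X k.succ + C (e k)) =
      (X k.succ + C (b k)) * X j.succ - C (c' - t) * X k.succ + C (e k + b k * t) := by
  have hkj' : k.succ ≠ j.succ := fun h => hkj (Fin.succ_injective _ h)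
  simp only [map_add, map_sub, map_mul, AffinePointBlowup.translateEquiv_X, translateEquiv_single_C, Pi.single_eq_same,
    Pi.single_eq_of_ne hkj', C_0, add_zero]
  ring

/-- The translations `y_j ↦ y_j + t` and `y_j ↦ y_j − t` are mutually inverse (as ring maps of `K[y_0, …, y_4]`). -/
theorem translateEquiv_single_comp_neg (t : K) :
    ((AffinePointBlowup.translateEquiv (n := 4) (Pi.single j.succ t) : A 4 K ≃ₐ[K] A 4 K) : A 4 K →+* A 4 K).comp
        ((AffinePointBlowup.translateEquiv (n := 4) (Pi.single j.succ (-t)) : A 4 K ≃ₐ[K] A 4 K) : A 4 K →+* A 4 K) =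
      RingHom.id (A 4 K) := by
  refine MvPolynomial.ringHom_ext (fun a => ?_) (fun m => ?_)
  · rw [RingHom.comp_apply, RingHom.id_apply, RingHom.coe_coe, RingHom.coe_coe, translateEquiv_single_C, translateEquiv_single_C]
  · rw [RingHom.comp_apply, RingHom.id_apply, RingHom.coe_coe, RingHom.coe_coe, AffinePointBlowup.translateEquiv_X, map_add,
      AffinePointBlowup.translateEquiv_X, translateEquiv_single_C, add_assoc, ← C_add]
    by_cases hm : m = j.succ
    · subst hm
      rw [Pi.single_eq_same, Pi.single_eq_same, add_neg_cancel, C_0, add_zero]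
    · rw [Pi.single_eq_of_ne hm, Pi.single_eq_of_ne hm, add_zero, C_0, add_zero]

/-- **R1 AT A SECOND HEIGHT.** In R1's frame (`Σ′ = V(y_0, y_T, y_j)`, `j ∉ T`, first resonance at `y_j = 0`, old exceptional hyperplane at
`y_j = c′`), let `ψ` be the automorphism of `𝔸⁵` induced by `y_j ↦ y_j − δ`; then `ψ^*𝓘(Σ′)` cuts out `Σ″ = V(y_0, y_T, y_j − δ)`, and the
chart-model boundary (hyperplanes `(y_m + a)·𝒪`, `(m, a) ∈ H`; translated far quadrics `TQ_k = ((y_k + b_k)·y_j − c′·y_k + e_k)·𝒪`, `k ∈ fs`,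
`j ∉ fs`, `e_k + b_k c′ ≠ 0`; (C1)) is snc with it provided `c′ ≠ δ` (`Σ″` is not on the old exceptional hyperplane). -/
theorem hasSNCWith_𝓘Λ_insert_comap_translate_of_forall_mem_far_translated (hjT : j ∉ T) (hc'δ : c' - δ ≠ 0)
    (H : Finset (Fin (4 + 1) × K)) (fs : Finset (Fin 4)) (hjfs : j ∉ fs) (hd : ∀ k ∈ fs, e k + b k * c' ≠ 0)
    (hC1 : ∀ k ∈ fs, ∀ a : K, (k.succ, a) ∈ H → a = b k) {E : List (Scheme.IdealSheafData (P 4 K))}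
    (hE : ∀ D ∈ E, D = ⊤ ∨ (∃ ma ∈ H, D = ofIdealTop (Ideal.span {(γ 4 K).symm (X ma.1 + C ma.2)})) ∨
      ∃ k ∈ fs, D = ofIdealTop (Ideal.span {(γ 4 K).symm ((X k.succ + C (b k)) * X j.succ - C c' * X k.succ + C (e k))})) :
    HasSNCWith E ((AffineCoordBlowup.𝓘Λ 4 K (insert 0 (Fin.succ '' ((insert j T : Finset (Fin 4)) : Set (Fin 4))))).comap
      (Spec.map (CommRingCat.ofHom ((AffinePointBlowup.translateEquiv (n := 4) (Pi.single j.succ (-δ)) : A 4 K ≃ₐ[K] A 4 K) :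
        A 4 K →+* A 4 K)))) := by
  classical
  set Λ : Set (Fin (4 + 1)) := insert 0 (Fin.succ '' ((insert j T : Finset (Fin 4)) : Set (Fin 4))) with hΛ
  set θm : A 4 K ≃ₐ[K] A 4 K := AffinePointBlowup.translateEquiv (n := 4) (Pi.single j.succ (-δ)) with hθm
  set θp : A 4 K ≃ₐ[K] A 4 K := AffinePointBlowup.translateEquiv (n := 4) (Pi.single j.succ δ) with hθp
  haveI hisop : IsIso (CommRingCat.ofHom (θp : A 4 K →+* A 4 K)) := (inferInstance : IsIso θp.toRingEquiv.toCommRingCatIso.hom)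
  set ψ' := Spec.map (CommRingCat.ofHom (θp : A 4 K →+* A 4 K)) with hψ'
  -- `ψ' ≫ ψ = 𝟙`: the two translations are mutually inverse
  have hcomp : ψ' ≫ Spec.map (CommRingCat.ofHom (θm : A 4 K →+* A 4 K)) = 𝟙 _ := by
    rw [hψ', ← Spec.map_comp, ← CommRingCat.ofHom_comp, hθp, hθm, translateEquiv_single_comp_neg, CommRingCat.ofHom_id, Spec.map_id]
  refine HasSNCWith.of_comap_of_isLocalIso ψ' ?_
  rw [← Scheme.IdealSheafData.comap_comp, hcomp, Scheme.IdealSheafData.comap_id]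
  -- the members in the frame `y_j ↦ y_j − δ`: R1 with `c′ − δ`, `e + b·δ`
  refine hasSNCWith_𝓘Λ_insert_of_forall_mem_far_translated (b := b) (e := fun k => e k + b k * δ) (c' := c' - δ) hjT hc'δ
    (H.image fun ma => (ma.1, Pi.single (M := fun _ => K) j.succ δ ma.1 + ma.2)) fs hjfs (fun k hk => ?_) (fun k hk a ha => ?_) ?_
  · have e1 : e k + b k * δ + b k * (c' - δ) = e k + b k * c' := by ring
    rw [e1]
    exact hd k hk
  · obtain ⟨ma, hma, hka⟩ := Finset.mem_image.mp ha
    obtain ⟨h1, h2⟩ := Prod.mk.inj hka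
    have hkj : ma.1 ≠ j.succ := fun h' => hjfs ((Fin.succ_injective _ (h1.symm.trans h')).symm ▸ hk)
    rw [← h2, h1, Pi.single_eq_of_ne (h1 ▸ hkj), zero_add]
    exact hC1 k hk ma.2 (h1 ▸ hma)
  · intro D hD
    obtain ⟨D₀, hD₀, rfl⟩ := List.mem_map.mp hD
    rcases hE D₀ hD₀ with h | ⟨ma, hma, h⟩ | ⟨k, hk, h⟩
    · left
      rw [h]
      simp only [Scheme.IdealSheafData.comap_top]
    · right; left
      refine ⟨(ma.1, Pi.single (M := fun _ => K) j.succ δ ma.1 + ma.2), Finset.mem_image.mpr ⟨ma, hma, rfl⟩, ?_⟩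
      simp only [h, hψ']
      rw [comap_ofIdealTop_span_γ_symm, RingHom.coe_coe, hθp, translateEquiv_single_hyperplane]
    · right; right
      refine ⟨k, hk, ?_⟩
      have hkj : k ≠ j := fun h' => hjfs (h' ▸ hk)
      simp only [h, hψ']
      rw [comap_ofIdealTop_span_γ_symm, RingHom.coe_coe, hθp, translateEquiv_single_tquadric (b := b) (e := e) (c' := c') δ hkj]

/-- **TWO RESONANT HEIGHTS: `Σ′ ⊔ Σ″` IS A REGULAR CENTRE SNC WITH THE WHOLE CHART-MODEL BOUNDARY.** In R1's frame (first resonance at `y_j = 0`,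
second at `y_j = δ`, `δ ≠ 0`, `c′ ≠ 0`, `c′ ≠ δ`): the product ideal sheaf `𝓘(Σ′)·ψ^*𝓘(Σ′)` (zero scheme `Σ′ ⊔ Σ″`) has disjoint factors, is snc
with the chart-model boundary, and has a regular zero scheme — the centre of the ONE blow-up removing the resonances at both heights
(Literature `IsBlowup.exists_comp_eq_of_disjoint_union` splits it into the two repairs R1–R5). Resolution of singularities in dimension ≥ 4 /
characteristic `p` is NOT proved. -/
theorem hasSNCWith_twoHeights_of_forall_mem_far_translated (hjT : j ∉ T) (hc' : c' ≠ 0) (hδ : δ ≠ 0) (hc'δ : c' - δ ≠ 0)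
    (H : Finset (Fin (4 + 1) × K)) (fs : Finset (Fin 4)) (hjfs : j ∉ fs) (hd : ∀ k ∈ fs, e k + b k * c' ≠ 0)
    (hC1 : ∀ k ∈ fs, ∀ a : K, (k.succ, a) ∈ H → a = b k) {E : List (Scheme.IdealSheafData (P 4 K))}
    (hE : ∀ D ∈ E, D = ⊤ ∨ (∃ ma ∈ H, D = ofIdealTop (Ideal.span {(γ 4 K).symm (X ma.1 + C ma.2)})) ∨
      ∃ k ∈ fs, D = ofIdealTop (Ideal.span {(γ 4 K).symm ((X k.succ + C (b k)) * X j.succ - C c' * X k.succ + C (e k))})) :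
    let C₁ := AffineCoordBlowup.𝓘Λ 4 K (insert 0 (Fin.succ '' ((insert j T : Finset (Fin 4)) : Set (Fin 4))))
    let ψ := Spec.map (CommRingCat.ofHom ((AffinePointBlowup.translateEquiv (n := 4) (Pi.single j.succ (-δ)) : A 4 K ≃ₐ[K] A 4 K) :
      A 4 K →+* A 4 K))
    Disjoint (C₁.support : Set (P 4 K)) (C₁.comap ψ).support ∧ HasSNCWith E (C₁ * C₁.comap ψ) ∧
      Scheme.IsRegular (C₁ * C₁.comap ψ).subscheme := by
  intro C₁ ψ
  set θm : A 4 K ≃ₐ[K] A 4 K := AffinePointBlowup.translateEquiv (n := 4) (Pi.single j.succ (-δ)) with hθm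
  haveI hisom : IsIso (CommRingCat.ofHom (θm : A 4 K →+* A 4 K)) := (inferInstance : IsIso θm.toRingEquiv.toCommRingCatIso.hom)
  have hjΛ : j.succ ∈ insert 0 (Fin.succ '' ((insert j T : Finset (Fin 4)) : Set (Fin 4))) :=
    Set.mem_insert_of_mem _ ⟨j, Finset.mem_coe.mpr (Finset.mem_insert_self j T), rfl⟩
  -- the two centres are disjoint: `y_j` and `y_j − δ` cannot both vanish
  have hdisj : Disjoint (C₁.support : Set (P 4 K)) (C₁.comap ψ).support := by
    rw [Set.disjoint_left]
    intro x hx1 hx2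
    rw [SetLike.mem_coe, AffineCoordBlowup.support_𝓘Λ, AffineCoordBlowup.mem_CΛ_iff'] at hx1
    rw [SetLike.mem_coe, Scheme.IdealSheafData.support_comap] at hx2
    have hx2' : ψ.base x ∈ AffineCoordBlowup.CΛ 4 K (insert 0 (Fin.succ '' ((insert j T : Finset (Fin 4)) : Set (Fin 4)))) := by
      rw [← AffineCoordBlowup.support_𝓘Λ]
      exact hx2
    have h2 := (AffineCoordBlowup.mem_CΛ_iff' 4 K _ _).mp hx2' j.succ hjΛ
    change (X j.succ : A 4 K) ∈ ((Spec.map (CommRingCat.ofHom (θm : A 4 K →+* A 4 K))) x).asIdeal at h2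
    rw [Spec.map_apply, PrimeSpectrum.comap_asIdeal, Ideal.mem_comap, CommRingCat.hom_ofHom, RingHom.coe_coe, hθm,
      AffinePointBlowup.translateEquiv_X, Pi.single_eq_same] at h2
    have h3 := x.asIdeal.sub_mem h2 (hx1 j.succ hjΛ)
    rw [add_sub_cancel_left, C_mem_asIdeal_iff, neg_eq_zero] at h3
    exact hδ h3
  refine ⟨hdisj, ?_, ?_⟩
  · exact hasSNCWith_mul_of_disjoint_support
      (hasSNCWith_𝓘Λ_insert_of_forall_mem_far_translated hjT hc' H fs hjfs hd hC1 hE)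
      (hasSNCWith_𝓘Λ_insert_comap_translate_of_forall_mem_far_translated hjT hc'δ H fs hjfs hd hC1 hE) hdisj
  · exact isRegular_subscheme_mul_of_disjoint_support
      (Literature.AlgebraicGeometry.Hironaka2017.Lib.AffineCoordBlowupLSB.isRegular_CΛ 4 K _)
      (isRegular_subscheme_comap_𝓘Λ ψ _) hdisj

end TwoHeights

end ChartDictionary

end Summit.ResolutionOfSingularities.ResolutionOfSingularities.Theorems.PIDim4

end
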